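import Summits.QuantumFields.BalabanUV.Beta.GAN24.HkKingOneStep

/-!
# `BalabanUV.Beta.GAN24.HkKingOneStepSup` — binder row G-an2-4 ∕ (CONV-C), route R7: the `H_k` one-step law against King's parent map
# (companion `HkKingOneStep`) READ AS ROW SUMS, AS A `sup → sup` LAW ON BOUNDED UNIT-LATTICE FIELDS, AND AT AN ARBITRARY FINE POINT
# against `BalabanAveragedTowerModes.par` — every torus, volume-uniform, constants functions of `d` alone

NOT IN PRINT; OUR PROOF ATTEMPT (prover part P3 of row G-an2-4, fibre∕strip («Woodbury») lineage, gen 27; CRUX TEAM (2), ruling «YM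
REDIRECT TOWARDS THE SUMMIT», 2026-08-21).  HONEST DEPENDENCY (cell records, verbatim): «continuum YM on T⁴ ⇐ BetaPertH ∧ nine spine
estimates (0/9 proved); BetaPertH ⇐ (D1) ∧ (D4) ∧ CAP+tail; G-an2-4 gates asym, D1 and NE2/3/4.»  HONEST FRAMING (cell contract, verbatim):
«discharging `BetaPertH` makes Bałaban's UV stability UNCONDITIONAL — a real constructive-QFT result; it is NOT the continuum limit and NOT
the Clay problem.»  ABSOLUTE RULE: nothing printed is a hypothesis; no `def … : Prop`, no sorry; [folklore] assembly over TREE objects BY NAME.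

## Content

`HkKingOneStep.norm_HkOp_king_sub_le` gives, entry by entry, `‖H_{RN}((RN·ȳ′+a′,μ),(ȳ,λ)) − H_N((N·ȳ′+⌊a′∕R⌋,μ),(ȳ,λ))‖ ≤ KH1(d)∕N·e^{−dec·|y′−y|_T}`.
 * §1 `KH1s d := KH1 d·(d+1)·latticeConst(d+1, dec d)`; **`sum_norm_HkOp_king_sub_le`**: the row sums are `≤ KH1s(d)∕N` UNIFORMLY IN THE TORUS
   (King's lattice constant, `B5Hk163TorusHolderRate.sum_exp_torusSupNorm_sub_rep_le`); **`norm_HkOp_king_mulVec_sub_le`**: for `‖B‖_∞ ≤ b`,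
   `‖(H_{RN}B)_μ(RN·ȳ′+a′) − (H_N B)_μ(N·ȳ′+⌊a′∕R⌋)‖ ≤ KH1s(d)∕N·b` — King's (3.71) `sup → sup` shape for Bałaban's vector `H_k` at `U = 1`.
 * §2 **`par_bpt`** (`par N R M (RN·y + a′) = N·y + ⌊a′∕R⌋`), `parDigit`, `eq_bpt_and_par_eq`, the entry law `norm_HkOp_par_sub_le` and the
   two summed laws at an ARBITRARY fine bond `X′`
   against `(par X′.1, X′.2)` = the lineage's `BlockPairingGeometry.parT`: **`sum_norm_HkOp_par_sub_le`**, **`norm_HkOp_par_mulVec_sub_le`** —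
   the currency of the `hc` sockets of `DressedOrderZeroChainRate` (consumed by `SoftColumnConsistency`).
 * §3 **`hk_king_two_clauses_lev`**: the tower reading `n_k = L^k` — (CONV-C)'s TWO CLAUSES for the constituent `H` at `U = 1` (uniform decay
   `B5Hk163Torus.norm_HkOp_le` ∧ one-step rate `C·(L⁻¹)^k·e^{−κ…}` against the parent), every fine bond, ONE declaration for the census.

HONEST SCOPE.  [folklore] bookkeeping BY NAME over `HkKingOneStep`; `U = 1`; rate `θ = L⁻¹`; constants ours, crude, `d`-only; NOT (CONV-C) as a
whole, NEVER «G-an2-4 closed», NOT NE2, NOT D1, NOT BetaPertH, NOT continuum, NOT Clay.  Locators (text only): [King1986] p. 664 (the pairing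
`x′ ↦ x`), (2.10) p. 653, Prop. 3.8 (3.71) p. 664; [Balaban1984PropagatorsI] (1.63) p. 28.  Provenance: prover-b2b-balaban-gan24-p3-g27-0
(unit `b2b-balaban-gan24-p3`, gen 27), 2026-08-21.
-/

noncomputable section

open scoped BigOperators ComplexConjugate Matrix
open Finset

namespace Summit.QuantumFields.BalabanUV.Beta.GAN24.HkKingOneStepSup

open Literature.MathematicalPhysics.QuantumFieldTheory.Balaban1983to89
open Literature.MathematicalPhysics.QuantumFieldTheory.Balaban1983to89.B5Prop11Plancherel (Tor fine unitVec)
open Literature.MathematicalPhysics.QuantumFieldTheory.Balaban1983to89.B4TorusKernel.MultiPeriod (torusSupNorm)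
open Literature.MathematicalPhysics.QuantumFieldTheory.Balaban1983to89.B4Sect5Proof (latticeConst latticeConst_nonneg)
open Literature.MathematicalPhysics.QuantumFieldTheory.Balaban1983to89.B5Block118 (bpt)
open Literature.MathematicalPhysics.QuantumFieldTheory.Balaban1983to89.B5Blocks16 (blockOf bpt_val)
open Literature.MathematicalPhysics.QuantumFieldTheory.Balaban1983to89.B6LowerBound2153Torus (toT rep toT_rep)
open Literature.MathematicalPhysics.QuantumFieldTheory.Balaban1983to89.B5Hk163Torus (HkOp)
open Literature.MathematicalPhysics.QuantumFieldTheory.Balaban1983to89.B5Hk163TorusHolderRate (sum_exp_torusSupNorm_sub_rep_le)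
open Literature.MathematicalPhysics.QuantumFieldTheory.Balaban1983to89.Beta.FluctuationProjection (digitOf bpt_blockOf_digitOf)
open Summit.QuantumFields.BalabanUV.T4Continuum.BalabanAveragedTowerModes (par val_par)
open Summit.QuantumFields.BalabanUV.Beta.GAN24.HkKingOneStep (dec dec_pos KH1 KH1_nonneg norm_HkOp_king_sub_le)

variable {d : ℕ}

/-! ## §1 Row sums and the `sup → sup` law on bounded unit-lattice fields (volume-uniform) -/

/-- the row-sum constant `KH1 d · (d+1) · latticeConst(d+1, dec d)`. OURS. [folklore] -/
def KH1s (d : ℕ) : ℝ := KH1 d * ((d + 1) * latticeConst (d + 1) (dec d))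

/-- `0 ≤ KH1s d`. [folklore] -/
theorem KH1s_nonneg (d : ℕ) : 0 ≤ KH1s d := by
  have h1 := KH1_nonneg d
  have h3 : (0 : ℝ) ≤ latticeConst (d + 1) (dec d) := latticeConst_nonneg _ (dec_pos d).le
  unfold KH1s; positivity


section King

variable {N R : ℕ} [NeZero N] [NeZero R] (M : Fin (d + 1) → ℕ) [hM : ∀ μ, NeZero (M μ)]

/-- **ROW SUMS**: `Σ_{(y,λ)} ‖H_{RN}((RN·ȳ′+a′,μ),(y,λ)) − H_N((N·ȳ′+⌊a′∕R⌋,μ),(y,λ))‖ ≤ KH1s(d)∕N` — uniformly in the torus (King's lattice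
constant, `B5Hk163TorusHolderRate.sum_exp_torusSupNorm_sub_rep_le`). [folklore] -/
theorem sum_norm_HkOp_king_sub_le (μ : Fin (d + 1)) (x' : Fin (d + 1) → ℤ) (a : Fin (d + 1) → Fin N)
    (a' : Fin (d + 1) → Fin (R * N)) (hpar : ∀ ν, (a' ν : ℕ) / R = (a ν : ℕ)) :
    ∑ i : Tor M × Fin (d + 1), ‖HkOp (R * N) M (bpt (R * N) M (toT M x') a', μ) i - HkOp N M (bpt N M (toT M x') a, μ) i‖
      ≤ KH1s d / N := by
  have hN0 : (0 : ℝ) < N := by exact_mod_cast Nat.pos_of_ne_zero (NeZero.ne N)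
  rw [Fintype.sum_prod_type]
  calc ∑ y : Tor M, ∑ lam : Fin (d + 1),
          ‖HkOp (R * N) M (bpt (R * N) M (toT M x') a', μ) (y, lam) - HkOp N M (bpt N M (toT M x') a, μ) (y, lam)‖
      ≤ ∑ y : Tor M, ∑ _lam : Fin (d + 1), KH1 d / N * Real.exp (-(dec d * torusSupNorm M (x' - rep M y))) := by
        refine Finset.sum_le_sum fun y _ => Finset.sum_le_sum fun lam _ => ?_
        have h := norm_HkOp_king_sub_le M μ lam x' (rep M y) a a' hpar
        rwa [toT_rep] at h
    _ = KH1 d / N * ((d + 1) * ∑ y : Tor M, Real.exp (-(dec d * torusSupNorm M (x' - rep M y)))) := by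
        simp only [Finset.sum_const, Finset.card_univ, Fintype.card_fin, nsmul_eq_mul, Finset.mul_sum]
        refine Finset.sum_congr rfl fun y _ => ?_
        push_cast; ring
    _ ≤ KH1 d / N * ((d + 1) * latticeConst (d + 1) (dec d)) := by
        have hS := sum_exp_torusSupNorm_sub_rep_le M (dec_pos d) x'
        have hK : 0 ≤ KH1 d / N := div_nonneg (KH1_nonneg d) hN0.le
        exact mul_le_mul_of_nonneg_left (mul_le_mul_of_nonneg_left hS (by positivity)) hK
    _ = KH1s d / N := by rw [KH1s]; ring

/-- **THE `sup → sup` ONE-STEP LAW OF `H_k` AT `U = 1` ON BOUNDED UNIT-LATTICE FIELDS**: for `‖B‖_∞ ≤ b`,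
`‖(H_{RN}B)_μ(RN·ȳ′+a′) − (H_N B)_μ(N·ȳ′+⌊a′∕R⌋)‖ ≤ KH1s(d)∕N · b` — every torus, volume-uniform, `d`-only constant (King's (3.71) shape for
Bałaban's vector `H_k`). [cite: King1986, Prop. 3.8 (3.71) p.664 (scalar template)] [folklore] -/
theorem norm_HkOp_king_mulVec_sub_le (B : Tor M × Fin (d + 1) → ℂ) {b : ℝ} (hb : ∀ i, ‖B i‖ ≤ b) (μ : Fin (d + 1))
    (x' : Fin (d + 1) → ℤ) (a : Fin (d + 1) → Fin N) (a' : Fin (d + 1) → Fin (R * N)) (hpar : ∀ ν, (a' ν : ℕ) / R = (a ν : ℕ)) :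
    ‖(HkOp (R * N) M *ᵥ B) (bpt (R * N) M (toT M x') a', μ) - (HkOp N M *ᵥ B) (bpt N M (toT M x') a, μ)‖ ≤ KH1s d / N * b := by
  have hb0 : 0 ≤ b := (norm_nonneg _).trans (hb ((0 : Tor M), μ))
  have e : (HkOp (R * N) M *ᵥ B) (bpt (R * N) M (toT M x') a', μ) - (HkOp N M *ᵥ B) (bpt N M (toT M x') a, μ)
      = ∑ i, (HkOp (R * N) M (bpt (R * N) M (toT M x') a', μ) i - HkOp N M (bpt N M (toT M x') a, μ) i) * B i := by
    simp only [Matrix.mulVec, dotProduct, ← Finset.sum_sub_distrib, sub_mul]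
  rw [e]
  calc _ ≤ ∑ i, ‖(HkOp (R * N) M (bpt (R * N) M (toT M x') a', μ) i - HkOp N M (bpt N M (toT M x') a, μ) i) * B i‖ := norm_sum_le _ _
    _ ≤ ∑ i, ‖HkOp (R * N) M (bpt (R * N) M (toT M x') a', μ) i - HkOp N M (bpt N M (toT M x') a, μ) i‖ * b := by
        refine Finset.sum_le_sum fun i _ => ?_
        rw [norm_mul]
        exact mul_le_mul_of_nonneg_left (hb i) (norm_nonneg _)
    _ = (∑ i, ‖HkOp (R * N) M (bpt (R * N) M (toT M x') a', μ) i - HkOp N M (bpt N M (toT M x') a, μ) i‖) * b := by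
        rw [Finset.sum_mul]
    _ ≤ KH1s d / N * b := mul_le_mul_of_nonneg_right (sum_norm_HkOp_king_sub_le M μ x' a a' hpar) hb0

/-! ## §2 The same at an arbitrary fine point against `BalabanAveragedTowerModes.par` -/

/-- **KING's PARENT OF A BLOCK POINT**: `par N R M (RN·y + a′) = N·y + ⌊a′∕R⌋` (values `(RN·y_ν + a′_ν)∕R = N·y_ν + ⌊a′_ν∕R⌋`).
[cite: King1986, (2.10) p.653 («B^k(y)»)] [folklore] -/
theorem par_bpt (y : Tor M) (a' : Fin (d + 1) → Fin (R * N)) :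
    par N R M (bpt (R * N) M y a')
      = bpt N M y (fun ν => ⟨(a' ν : ℕ) / R,
          (Nat.div_lt_iff_lt_mul (Nat.pos_of_ne_zero (NeZero.ne R))).mpr ((a' ν).isLt.trans_eq (Nat.mul_comm R N))⟩) := by
  have hR : 0 < R := Nat.pos_of_ne_zero (NeZero.ne R)
  funext ν
  apply ZMod.val_injective
  rw [val_par, bpt_val, bpt_val]
  show (R * N * (y ν).val + (a' ν : ℕ)) / R = N * (y ν).val + (a' ν : ℕ) / R
  rw [show R * N * (y ν).val + (a' ν : ℕ) = (a' ν : ℕ) + R * (N * (y ν).val) by ring, Nat.add_mul_div_left _ _ hR]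
  ring

/-- the digit of the parent: `⌊(digitOf x′)_ν ∕ R⌋`. OURS (bookkeeping). [folklore] -/
def parDigit (x' : Tor (fine (R * N) M)) : Fin (d + 1) → Fin N :=
  fun ν => ⟨(digitOf (R * N) M x' ν : ℕ) / R,
    (Nat.div_lt_iff_lt_mul (Nat.pos_of_ne_zero (NeZero.ne R))).mpr ((digitOf (R * N) M x' ν).isLt.trans_eq (Nat.mul_comm R N))⟩

/-- every fine point and its parent in block coordinates: `x′ = RN·ȳ + digitOf x′`, `par x′ = N·ȳ + parDigit x′` with `ȳ = toT (rep (blockOf x′))`.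
[folklore] -/
theorem eq_bpt_and_par_eq (x' : Tor (fine (R * N) M)) :
    x' = bpt (R * N) M (toT M (rep M (blockOf (R * N) M x'))) (digitOf (R * N) M x') ∧
      par N R M x' = bpt N M (toT M (rep M (blockOf (R * N) M x'))) (parDigit M x') := by
  have hx : x' = bpt (R * N) M (toT M (rep M (blockOf (R * N) M x'))) (digitOf (R * N) M x') := by
    rw [toT_rep, bpt_blockOf_digitOf]
  refine ⟨hx, ?_⟩
  conv_lhs => rw [hx]
  rw [par_bpt]
  rfl

/-- **THE ENTRY LAW AT AN ARBITRARY FINE BOND** `X′` of level `RN` against its parent: with `ȳ′ = rep (blockOf X′.1)`,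
`‖H_{RN}(X′, (ȳ, λ)) − H_N(par X′, (ȳ, λ))‖ ≤ KH1(d)∕N · e^{−dec·|ȳ′ − y|_T}` for every lattice representative `y`. [folklore] -/
theorem norm_HkOp_par_sub_le (X' : Tor (fine (R * N) M) × Fin (d + 1)) (y : Fin (d + 1) → ℤ) (lam : Fin (d + 1)) :
    ‖HkOp (R * N) M X' (toT M y, lam) - HkOp N M (par N R M X'.1, X'.2) (toT M y, lam)‖
      ≤ KH1 d / N * Real.exp (-(dec d * torusSupNorm M (rep M (blockOf (R * N) M X'.1) - y))) := by
  obtain ⟨x', μ⟩ := X'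
  obtain ⟨hx, hp⟩ := eq_bpt_and_par_eq (N := N) (R := R) M x'
  dsimp only
  rw [hp]
  have h := norm_HkOp_king_sub_le M μ lam (rep M (blockOf (R * N) M x')) y (parDigit M x') (digitOf (R * N) M x')
    (fun ν => rfl)
  rw [← hx] at h
  exact h

/-- **ROW SUMS AT AN ARBITRARY FINE POINT**: `Σ_i ‖H_{RN}(X′, i) − H_N(par X′, i)‖ ≤ KH1s(d)∕N` for every fine bond `X′ = (x′, μ)` of level `RN`.
[folklore] -/
theorem sum_norm_HkOp_par_sub_le (X' : Tor (fine (R * N) M) × Fin (d + 1)) :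
    ∑ i : Tor M × Fin (d + 1), ‖HkOp (R * N) M X' i - HkOp N M (par N R M X'.1, X'.2) i‖ ≤ KH1s d / N := by
  obtain ⟨x', μ⟩ := X'
  obtain ⟨hx, hp⟩ := eq_bpt_and_par_eq (N := N) (R := R) M x'
  dsimp only
  rw [hp]
  have key := sum_norm_HkOp_king_sub_le M μ (rep M (blockOf (R * N) M x')) (parDigit M x') (digitOf (R * N) M x')
    (fun ν => rfl)
  rw [← hx] at key
  exact key

/-- **THE `sup → sup` LAW AT AN ARBITRARY FINE POINT**: `‖(H_{RN}B)(X′) − (H_N B)(par X′)‖ ≤ KH1s(d)∕N · ‖B‖_∞`. [folklore] -/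
theorem norm_HkOp_par_mulVec_sub_le (B : Tor M × Fin (d + 1) → ℂ) {b : ℝ} (hb : ∀ i, ‖B i‖ ≤ b)
    (X' : Tor (fine (R * N) M) × Fin (d + 1)) :
    ‖(HkOp (R * N) M *ᵥ B) X' - (HkOp N M *ᵥ B) (par N R M X'.1, X'.2)‖ ≤ KH1s d / N * b := by
  obtain ⟨x', μ⟩ := X'
  obtain ⟨hx, hp⟩ := eq_bpt_and_par_eq (N := N) (R := R) M x'
  dsimp only
  rw [hp]
  have key := norm_HkOp_king_mulVec_sub_le M B hb μ (rep M (blockOf (R * N) M x')) (parDigit M x') (digitOf (R * N) M x')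
    (fun ν => rfl)
  rw [← hx] at key
  exact key

end King

/-! ## §3 The tower reading `N = L^k`, `R = L`: (CONV-C)'s two clauses for the constituent `H` at `U = 1`, every fine bond -/

section Tower

open Literature.MathematicalPhysics.QuantumFieldTheory.Balaban1983to89.B5G183RateUnitTower (lev lev_neZero)
open Literature.MathematicalPhysics.QuantumFieldTheory.Balaban1983to89.B4TorusKernel (periodConst)
open Literature.MathematicalPhysics.QuantumFieldTheory.Balaban1983to89.B5Kernel166Decay (periodConst_pos)
open Literature.MathematicalPhysics.QuantumFieldTheory.Balaban1983to89.B5Hk163Strip (kappa163 kappa163_pos)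
open Literature.MathematicalPhysics.QuantumFieldTheory.Balaban1983to89.B5Hk163Decay (MG163 MG163_nonneg)
open Summit.QuantumFields.BalabanUV.T4Continuum.BalabanAveragedTowerUnit (one_le_lev' cast_lev')
open Summit.QuantumFields.BalabanUV.Beta.GAN24.HkKingOneStep (norm_HkOp_bpt_le)

variable (L : ℕ) [NeZero L] (M : Fin (d + 1) → ℕ) [hM : ∀ μ, NeZero (M μ)]

/-- **THE CONSTITUENT `H` OF (CONV-C) AT `U = 1` ALONG THE TOWER `n_k = L^k`, KING-PARENT CURRENCY, EVERY TORUS, EVERY FINE BOND** — one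
declaration for the census: there are `κ > 0`, `C ≥ 0` (functions of `d` alone) with, for every level `k`, fine bond `X′` of level `k+1`
(resp. `X` of level `k`), unit point `y` and component `λ`, writing `ȳ(X)` for the lattice representative of the block of `X`:
 (i) `‖H_k(X, (y,λ))‖ ≤ C·e^{−κ|ȳ(X) − ȳ(y)|_T}`;  (ii) `‖H_{k+1}(X′, (y,λ)) − H_k(par X′, (y,λ))‖ ≤ C·(L⁻¹)^k·e^{−κ|ȳ(X′) − ȳ(y)|_T}`.
[cite: King1986, p.664 (the pairing x′ ↦ x), Prop. 3.8 (3.71) p.664 (scalar template); Balaban1984PropagatorsI, (1.63) p.28] [folklore] -/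
theorem hk_king_two_clauses_lev :
    ∃ κ C : ℝ, 0 < κ ∧ 0 ≤ C ∧
      (∀ (k : ℕ) (X : Tor (fine (lev L k) M) × Fin (d + 1)) (y : Tor M) (lam : Fin (d + 1)),
        ‖HkOp (lev L k) M X (y, lam)‖
          ≤ C * Real.exp (-(κ * torusSupNorm M (rep M (blockOf (lev L k) M X.1) - rep M y)))) ∧
      (∀ (k : ℕ) (X' : Tor (fine (L * lev L k) M) × Fin (d + 1)) (y : Tor M) (lam : Fin (d + 1)),
        ‖HkOp (L * lev L k) M X' (y, lam) - HkOp (lev L k) M (par (lev L k) L M X'.1, X'.2) (y, lam)‖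
          ≤ C * ((L : ℝ)⁻¹) ^ k * Real.exp (-(κ * torusSupNorm M (rep M (blockOf (L * lev L k) M X'.1) - rep M y)))) := by
  refine ⟨dec d, max (MG163 (d + 1) * periodConst (kappa163 (d + 1)) d) (KH1 d), dec_pos d,
    le_max_of_le_right (KH1_nonneg d), ?_, ?_⟩
  · intro k X y lam
    obtain ⟨x, μ⟩ := X
    have hx : x = bpt (lev L k) M (toT M (rep M (blockOf (lev L k) M x))) (digitOf (lev L k) M x) := by
      rw [toT_rep, bpt_blockOf_digitOf]
    have h := norm_HkOp_bpt_le (lev L k) M μ lam (digitOf (lev L k) M x) (rep M (blockOf (lev L k) M x)) (rep M y)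
    rw [← hx, toT_rep] at h
    exact h.trans (mul_le_mul_of_nonneg_right (le_max_left _ _) (Real.exp_pos _).le)
  · intro k X' y lam
    obtain ⟨x', μ⟩ := X'
    obtain ⟨hx, hp⟩ := eq_bpt_and_par_eq (N := lev L k) (R := L) M x'
    dsimp only
    rw [hp]
    have h := norm_HkOp_king_sub_le M μ lam (rep M (blockOf (L * lev L k) M x')) (rep M y) (parDigit M x')
      (digitOf (L * lev L k) M x') (fun ν => rfl)
    rw [← hx, toT_rep] at h
    refine h.trans ?_
    rw [cast_lev', div_eq_mul_inv, ← inv_pow]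
    exact mul_le_mul_of_nonneg_right (mul_le_mul_of_nonneg_right (le_max_right _ _) (by positivity)) (Real.exp_pos _).le

end Tower

end Summit.QuantumFields.BalabanUV.Beta.GAN24.HkKingOneStepSup

end
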